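import Literature.NumberTheory.Rogawski1990.ArchHyperbolicOrbitMeasureThree    -- ★ p849356 LH2-p03 (g3): Sylvester transport, slab function, THE BOX `nsq_le_of_chart_mem_hsOrbitBall_slab`, THE BALL PICTURE; via imports ★ (Z″)∕`chi_onto` (p849262)
import Literature.Geometry.ComplexHyperbolic.UnitBallInvariantMeasure           -- ★ `isCompact_setOf_smul_x₀_mem` (the orbit map `U(2,1) → 𝔹²` is proper)
import Literature.NumberTheory.Automorphic.UnitaryFormGroupUnimodular            -- ★ `locallyCompactSpace_unitaryGroupOfForm_complex`
import HarnessLib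

/-!
# Uniform properness modulo the SPLIT Cartan of `U(2,1) = U(Φ₃)(ℂ)` and continuity of the Weil-quotient orbital integral along it
# («(W1-cont-split)» L2 + L3: Beuzart-Plessis 2020 §1.2, §1.8; Rogawski 1990 §3.6, §8.3; Shelstad 1979 §4)

Topic `NumberTheory/Rogawski1990`; namespace `Literature.NumberTheory.Rogawski1990`.  THEOREMS ONLY (no `def`, no instance, no notation, no axiom, no named fact, no
`sorry`).  Cell `pub/hodgecm-mathlib`, crux H413 (`stmt-HodgeConjecture-24833`), F0∕P3c line LH3 (closer stub `stub_N9`; DIRECT ROAD memo `MEMO-N9-direct-road.v1`, clause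
(M1) «`Transf_Δ″` lands in `I^st_c(H_∞)`: continuity on the regular set of each Cartan»); seat LH3-p03 (g2), organ «(W1-cont-split)» of LH3-plan (g2) DEALER WORDS #3 (g2)
2026-09-02T05:13:20Z.  (VOL)∕(CONV) kit under the letters, count-neutral (+0∕+0).

THE MATHEMATICS.  `U := U(Φ₃)(ℂ)` (★ `unitaryGroupOfForm (starRingEnd ℂ) Φ₃`), `γ₁ = diag(α₁, u₁, ᾱ₁⁻¹)` a REGULAR element of the SPLIT Cartan (`|u₁| = 1 ≠ |α₁|`),
`T := Z(γ₁)` = the diagonal torus `{diag(a, b, ā⁻¹) : |b| = 1}` (★ (Z″) p849262: its elements are diagonal, `t̄₀₀ t₂₂ = 1`, `|t₁₁| = 1`), NON-compact (`≅ ℂˣ × S¹`), regular set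
`T_reg = {t ∈ T ∣ |t₀₀| ≠ 1}`.  For the partners in `G′_w ≅ U(2,1)` of a SPLIT `H`-torus family the orbital integrals are Weil QUOTIENT integrals over the fixed quotient
`U ⧸ T` (the centraliser is not compact, the group integral diverges); their continuity in the torus parameter needs UNIFORM PROPERNESS MODULO `T`:
* §1 `coe_eq_diagHyp_of_mem_centralizer` — every `t ∈ T` has matrix `diag(t₀₀, t₁₁, t̄₀₀⁻¹)` with `|t₁₁| = 1` (so ★ p849356's slab∕box∕ball lemmas apply AT EVERY `t ∈ T_reg`);
  `centralizer_mul_comm_of_diag_hyperbolic` — `T` is abelian.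
* §2 **`exists_isCompact_forall_hsOrbit_subset_of_diag_hyperbolic` (L2, UNIFORM PROPERNESS mod `T`)**: for compact `K ⊆ T_reg` and `R` there is a compact `𝒦 ⊆ U ⧸ T` with
  `ȳ ∈ 𝒦` whenever `‖y t y⁻¹‖²_HS ≤ R` for some `t ∈ K`.  PROOF (all inputs ★): `g := y⁻¹`; a `T`-translate `τ g` lies in the slab `s ∈ [1, 2]` (★ `chi_onto`, ★ `slabFun_centralizer_mul`;
  `T` abelian so the orbit-ball condition is `T`-invariant); orbit ball ∩ slab ⊆ Sylvester-preimage of the orbit-map preimage of `D_R(t)` (★ `hsOrbitBall_inter_slab_subset_preimage`);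
  `D_R(t) ⊆ chart{|W|² ≤ K(t₀₀)·√(R+1)}` (★ THE BOX `nsq_le_of_chart_mem_hsOrbitBall_slab`, ★ `chart_unchart`), `K(·)` continuous on `|a| ≠ 1` hence bounded on `K`; the orbit map is
  proper (★ `isCompact_setOf_smul_x₀_mem`); `ȳ = (τ g)⁻¹ T`.
* §3 **`continuousOn_integral_descConj_of_diag_hyperbolic` (L3)**: for `a ∈ C_c(U, E)` and ANY measure `μ` on `U ⧸ T` finite on compact sets (e.g. the Weil quotient `dν ∕ dt_T`,
  ★ `quotientMeasure`), `t ↦ ∫_{U⧸T} a(y t y⁻¹) dμ(ȳ)` is `ContinuousOn T_reg` (Mathlib `continuousOn_integral_of_compact_support` over §2; joint continuity through the open quotient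
  map `id × mk`); `continuousOn_integral_descConj_comp_of_diag_hyperbolic` — along any continuous `c : Z → T` (the partner family of a split `H`-torus, `c(x, θ, z₁) =
  diag(e^{x+iθ}, z₁, e^{-x+iθ})`, regular iff `x ≠ 0`).  The non-compact-Cartan twin of ★ `continuousOn_integral_descConj_archDiagTorus_of_hasCompactSupport` (F0P3a-p06, compact tori).
NOT HERE (honest): the leaf's `m′`-currency `classOrbitalIntegral m′ a′ ⟦t⟧` differs from §3's integral by the family's free centraliser mass `κ(t)` (★ (D3)
`exists_classOrbitalIntegral_mk_eq_integral_descConj_smul_of_atPoint_eq`); continuity in that currency needs a per-Cartan normalisation clause not contained in ★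
`ArchCompatibleFamiliesG` (LH3-p03 census 2026-09-02, item (3)) — next file (L4).  Places∕carriers: the place factor `U(Φ₃)_w = U(Φ₃^ℂ)` by `Φ₃.map σ_w = Φ₃` (as in ★ p849205∕p849357).
HONEST LABEL: HC_CM is proved only modulo the 7 printed citations (2 remaining: hLiu418 = `stmt-HodgeConjecture-24832`, h413 = `stmt-HodgeConjecture-24833`) until rung 0
closes; this file is count-neutral kit for (M1) of L2 = «Transf is well-defined»; it pays no organ; books unchanged.

## References
* [BeuzartPlessis2020Asterisque] R. Beuzart-Plessis, *A local trace formula for the Gan–Gross–Prasad conjecture for unitary groups: the archimedean case*,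
  Astérisque 418 (2020), §1.2 (1.2.2), (1.2.4) p. 21 (`σ`, orbit vs group balls); §1.8 p. 39 (regular semisimple orbital integrals, Harish-Chandra descent).
* [Rogawski1990] J. D. Rogawski, *Automorphic Representations of Unitary Groups in Three Variables*, Ann. of Math. Stud. 123 (1990), §3.6 p. 31 (Cartan subgroups of
  `U(2,1)`), §4.9 p. 54, §8.3 p. 122 (orbital integrals as functions on `T_reg`).
* [Shelstad1979] D. Shelstad, *Characters and inner forms of a quasi-split group over ℝ*, Compositio Math. 39 (1979), §4 (orbital integrals on `T_reg`, arbitrary `dt`).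
* [Rudin1980] W. Rudin, *Function Theory in the Unit Ball of ℂⁿ* (1980), §2.2 (automorphisms of the ball, the orbit map).
* [DeitmarEchterhoff2014] A. Deitmar, S. Echterhoff, *Principles of Harmonic Analysis*, 2nd ed. (2014), Lemma 9.3.3 (orbital integrals of `C_c` functions), Thm. 1.5.3.
-/

set_option autoImplicit false

noncomputable section

open MeasureTheory MeasureTheory.Measure Set Complex ComplexConjugate Topology
open Literature.Geometry.ComplexHyperbolic Literature.Geometry.ComplexHyperbolic.BallModel
open Literature.AlgebraicGeometry.ShimuraVarieties.BallForms
open Literature.NumberTheory.Automorphic Literature.MeasureTheory.Group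
open scoped ENNReal NNReal MatrixGroups Matrix

namespace Literature.NumberTheory.Rogawski1990

/-! ## §1 The split Cartan `T = Z(γ₁)`: diagonal shape of its elements, commutativity -/

section Torus

variable {γ₁ : ↥(unitaryGroupOfForm (starRingEnd ℂ) (Matrix.of fun i j : Fin 3 => if i.val + j.val + 1 = 3 then (1 : ℂ) else 0))} {α₁ u₁ : ℂ}
  (hγ₁ : ((γ₁ : GL (Fin 3) ℂ) : Matrix (Fin 3) (Fin 3) ℂ) = !![α₁, 0, 0; 0, u₁, 0; 0, 0, (star α₁)⁻¹]) (hu₁ : ‖u₁‖ = 1) (hα₁1 : ‖α₁‖ ≠ 1)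

include hγ₁ hu₁ hα₁1 in
/-- **Every `t ∈ T = Z(γ₁)` has matrix `diag(t₀₀, t₁₁, t̄₀₀⁻¹)` with `|t₁₁| = 1`** (★ (Z″): `t` is diagonal, `t̄₀₀ t₂₂ = 1`, `|t₁₁| = 1`) — so every element of the split Cartan
is in the literal shape `!![a, 0, 0; 0, b, 0; 0, 0, (star a)⁻¹]` of ★ p849262 ∕ ★ p849356, REGULAR iff `|a| ≠ 1`. [cite: Rogawski1990, §3.6 p. 31] [cite: Knapp1986, Ch. V §3] -/
theorem coe_eq_diagHyp_of_mem_centralizer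
    {t : ↥(unitaryGroupOfForm (starRingEnd ℂ) (Matrix.of fun i j : Fin 3 => if i.val + j.val + 1 = 3 then (1 : ℂ) else 0))}
    (ht : t ∈ Subgroup.centralizer ({γ₁} : Set ↥(unitaryGroupOfForm (starRingEnd ℂ) (Matrix.of fun i j : Fin 3 => if i.val + j.val + 1 = 3 then (1 : ℂ) else 0)))) :
    ((t : GL (Fin 3) ℂ) : Matrix (Fin 3) (Fin 3) ℂ) =
        !![((t : GL (Fin 3) ℂ) : Matrix (Fin 3) (Fin 3) ℂ) 0 0, 0, 0; 0, ((t : GL (Fin 3) ℂ) : Matrix (Fin 3) (Fin 3) ℂ) 1 1, 0;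
          0, 0, (star (((t : GL (Fin 3) ℂ) : Matrix (Fin 3) (Fin 3) ℂ) 0 0))⁻¹] ∧
      ‖((t : GL (Fin 3) ℂ) : Matrix (Fin 3) (Fin 3) ℂ) 1 1‖ = 1 := by
  have h0 := fun i j (hij : i ≠ j) => apply_eq_zero_of_mem_centralizer_of_coe_eq_diagonal hγ₁ hu₁ hα₁1 ht hij
  have h22 : ((t : GL (Fin 3) ℂ) : Matrix (Fin 3) (Fin 3) ℂ) 2 2 = (star (((t : GL (Fin 3) ℂ) : Matrix (Fin 3) (Fin 3) ℂ) 0 0))⁻¹ :=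
    (inv_eq_of_mul_eq_one_right (conj_apply_zero_mul_apply_two_eq_one_of_mem_centralizer hγ₁ hu₁ hα₁1 ht)).symm
  refine ⟨?_, (norm_apply_of_mem_centralizer hγ₁ hu₁ hα₁1 ht).2⟩
  ext i j
  fin_cases i <;> fin_cases j
  · rfl
  · exact h0 0 1 (by decide)
  · exact h0 0 2 (by decide)
  · exact h0 1 0 (by decide)
  · rfl
  · exact h0 1 2 (by decide)
  · exact h0 2 0 (by decide)
  · exact h0 2 1 (by decide)
  · exact h22

include hγ₁ hu₁ hα₁1 in
/-- **`T = Z(γ₁)` is abelian** (its elements are diagonal). [cite: Rogawski1990, §3.6 p. 31] -/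
theorem centralizer_mul_comm_of_diag_hyperbolic
    {s t : ↥(unitaryGroupOfForm (starRingEnd ℂ) (Matrix.of fun i j : Fin 3 => if i.val + j.val + 1 = 3 then (1 : ℂ) else 0))}
    (hs : s ∈ Subgroup.centralizer ({γ₁} : Set ↥(unitaryGroupOfForm (starRingEnd ℂ) (Matrix.of fun i j : Fin 3 => if i.val + j.val + 1 = 3 then (1 : ℂ) else 0))))
    (ht : t ∈ Subgroup.centralizer ({γ₁} : Set ↥(unitaryGroupOfForm (starRingEnd ℂ) (Matrix.of fun i j : Fin 3 => if i.val + j.val + 1 = 3 then (1 : ℂ) else 0)))) :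
    s * t = t * s := by
  obtain ⟨hsM, -⟩ := coe_eq_diagHyp_of_mem_centralizer hγ₁ hu₁ hα₁1 hs
  obtain ⟨htM, -⟩ := coe_eq_diagHyp_of_mem_centralizer hγ₁ hu₁ hα₁1 ht
  apply Subtype.ext
  apply Units.ext
  show ((s : GL (Fin 3) ℂ) : Matrix (Fin 3) (Fin 3) ℂ) * ((t : GL (Fin 3) ℂ) : Matrix (Fin 3) (Fin 3) ℂ) =
    ((t : GL (Fin 3) ℂ) : Matrix (Fin 3) (Fin 3) ℂ) * ((s : GL (Fin 3) ℂ) : Matrix (Fin 3) (Fin 3) ℂ)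
  rw [hsM, htM]
  ext i j
  fin_cases i <;> fin_cases j <;> simp [Matrix.mul_apply, Fin.sum_univ_three] <;> ring

include hγ₁ hu₁ hα₁1 in
/-- The commuting proof consumed by ★ `descConj (t : U) (Z γ₁) _`: every `m ∈ T` commutes with every `t ∈ T`. [cite: Rogawski1990, §3.6 p. 31] -/
theorem forall_mem_centralizer_mul_comm
    (t : ↥(Subgroup.centralizer ({γ₁} : Set ↥(unitaryGroupOfForm (starRingEnd ℂ) (Matrix.of fun i j : Fin 3 => if i.val + j.val + 1 = 3 then (1 : ℂ) else 0))))) :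
    ∀ m ∈ Subgroup.centralizer ({γ₁} : Set ↥(unitaryGroupOfForm (starRingEnd ℂ) (Matrix.of fun i j : Fin 3 => if i.val + j.val + 1 = 3 then (1 : ℂ) else 0))),
      m * (t : ↥(unitaryGroupOfForm (starRingEnd ℂ) (Matrix.of fun i j : Fin 3 => if i.val + j.val + 1 = 3 then (1 : ℂ) else 0))) = t * m :=
  fun _ hm => centralizer_mul_comm_of_diag_hyperbolic hγ₁ hu₁ hα₁1 hm t.2

end Torus

/-! ## §2 (L2) Uniform properness modulo the split Cartan -/

section Proper

variable {γ₁ : ↥(unitaryGroupOfForm (starRingEnd ℂ) (Matrix.of fun i j : Fin 3 => if i.val + j.val + 1 = 3 then (1 : ℂ) else 0))} {α₁ u₁ : ℂ}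
  (hγ₁ : ((γ₁ : GL (Fin 3) ℂ) : Matrix (Fin 3) (Fin 3) ℂ) = !![α₁, 0, 0; 0, u₁, 0; 0, 0, (star α₁)⁻¹]) (hu₁ : ‖u₁‖ = 1) (hα₁1 : ‖α₁‖ ≠ 1)

/-- The sub-level sets of `|W|²` in `ℂ²` are compact. [folklore] [cite: Rudin1980, §2.2] -/
private theorem isCompact_setOf_nsq_le (c : ℝ) : IsCompact {W : Fin 2 → ℂ | nsq W ≤ c} := by
  have hcl : IsClosed {W : Fin 2 → ℂ | nsq W ≤ c} := isClosed_le continuous_fun_nsq continuous_const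
  refine (isCompact_closedBall (0 : Fin 2 → ℂ) (Real.sqrt (max c 0))).of_isClosed_subset hcl fun W hW => ?_
  rw [mem_closedBall_zero_iff, pi_norm_le_iff_of_nonneg (Real.sqrt_nonneg _)]
  intro i
  have hi : ‖W i‖ ^ 2 ≤ max c 0 := by
    have h := le_max_left c 0
    have hW' : nsq W ≤ c := hW
    fin_cases i
    · have : ‖W 1‖ ^ 2 ≥ 0 := by positivity
      simp only [nsq] at hW'; simp only [Fin.zero_eta]; linarith
    · have : ‖W 0‖ ^ 2 ≥ 0 := by positivity
      simp only [nsq] at hW'; simp only [Fin.mk_one]; linarith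
  calc ‖W i‖ = Real.sqrt (‖W i‖ ^ 2) := (Real.sqrt_sq (norm_nonneg _)).symm
    _ ≤ Real.sqrt (max c 0) := Real.sqrt_le_sqrt hi

/-- The box constant `K(a) = 3∕4 + (91∕16)·|a|(1∕2 + |a|∕(|a|−1)²)∕||a|²−1| + (7∕4)·|a|∕(|a|−1)²` of ★ `nsq_le_of_chart_mem_hsOrbitBall_slab` is continuous on `|a| ≠ 1`.
[cite: BeuzartPlessis2020Asterisque, §1.2 p. 21] -/
private theorem continuousOn_boxConst :
    ContinuousOn (fun a : ℂ => 3 / 4 + 91 / 16 * (‖a‖ * (1 / 2 + ‖a‖ / (‖a‖ - 1) ^ 2) / |‖a‖ ^ 2 - 1|) + 7 / 4 * (‖a‖ / (‖a‖ - 1) ^ 2)) {a : ℂ | ‖a‖ ≠ 1} := by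
  have hn : Continuous fun a : ℂ => ‖a‖ := continuous_norm
  have h1 : ∀ a ∈ {a : ℂ | ‖a‖ ≠ 1}, (‖a‖ - 1) ^ 2 ≠ 0 := fun a ha => pow_ne_zero 2 (sub_ne_zero.2 ha)
  have h2 : ∀ a ∈ {a : ℂ | ‖a‖ ≠ 1}, |‖a‖ ^ 2 - 1| ≠ 0 := fun a ha => by
    rw [abs_ne_zero, sub_ne_zero]
    intro h
    have : ‖a‖ = 1 := by nlinarith [norm_nonneg a]
    exact ha this
  have hKm : ContinuousOn (fun a : ℂ => ‖a‖ / (‖a‖ - 1) ^ 2) {a : ℂ | ‖a‖ ≠ 1} :=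
    hn.continuousOn.div ((hn.sub continuous_const).pow 2).continuousOn h1
  refine (continuousOn_const.add (continuousOn_const.mul ?_)).add (continuousOn_const.mul hKm)
  exact ((hn.continuousOn.mul (continuousOn_const.add hKm)).div ((hn.pow 2).sub continuous_const).continuousOn.abs h2)

include hγ₁ hu₁ hα₁1 in
/-- **(L2) UNIFORM PROPERNESS MODULO THE SPLIT CARTAN.**  For compact `K ⊆ T_reg = {t ∈ Z(γ₁) ∣ |t₀₀| ≠ 1}` and `R ∈ ℝ` there is a COMPACT `𝒦 ⊆ U ⧸ Z(γ₁)` such that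
`y Z(γ₁) ∈ 𝒦` whenever `‖y t y⁻¹‖²_HS ≤ R` for some `t ∈ K` — the orbit HS-balls of a compact family of regular split classes are uniformly bounded MODULO the torus.
PROOF: §1 + slab translate (★ `chi_onto`, ★ `slabFun_centralizer_mul`) + ★ `hsOrbitBall_inter_slab_subset_preimage` + ★ `nsq_le_of_chart_mem_hsOrbitBall_slab` (box constant bounded on
`K`) + ★ `chart_unchart` + ★ `isCompact_setOf_smul_x₀_mem`. [cite: BeuzartPlessis2020Asterisque, §1.2 (1.2.2), (1.2.4) p. 21; §1.8 p. 39] [cite: Rogawski1990, §8.3 p. 122]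
[cite: DeitmarEchterhoff2014, Lemma 9.3.3] -/
theorem exists_isCompact_forall_hsOrbit_subset_of_diag_hyperbolic
    {K : Set ↥(Subgroup.centralizer ({γ₁} : Set ↥(unitaryGroupOfForm (starRingEnd ℂ) (Matrix.of fun i j : Fin 3 => if i.val + j.val + 1 = 3 then (1 : ℂ) else 0))))}
    (hK : IsCompact K)
    (hKreg : ∀ t ∈ K, ‖((((t : ↥(Subgroup.centralizer ({γ₁} : Set _))) :
      ↥(unitaryGroupOfForm (starRingEnd ℂ) (Matrix.of fun i j : Fin 3 => if i.val + j.val + 1 = 3 then (1 : ℂ) else 0))) : GL (Fin 3) ℂ) : Matrix (Fin 3) (Fin 3) ℂ) 0 0‖ ≠ 1)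
    (R : ℝ) :
    ∃ 𝒦 : Set (↥(unitaryGroupOfForm (starRingEnd ℂ) (Matrix.of fun i j : Fin 3 => if i.val + j.val + 1 = 3 then (1 : ℂ) else 0)) ⧸
        Subgroup.centralizer ({γ₁} : Set ↥(unitaryGroupOfForm (starRingEnd ℂ) (Matrix.of fun i j : Fin 3 => if i.val + j.val + 1 = 3 then (1 : ℂ) else 0)))),
      IsCompact 𝒦 ∧
        ∀ t ∈ K, ∀ y : ↥(unitaryGroupOfForm (starRingEnd ℂ) (Matrix.of fun i j : Fin 3 => if i.val + j.val + 1 = 3 then (1 : ℂ) else 0)),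
          ∑ i : Fin 3, ∑ j : Fin 3, ‖(((y * (t : ↥(unitaryGroupOfForm (starRingEnd ℂ) (Matrix.of fun i j : Fin 3 => if i.val + j.val + 1 = 3 then (1 : ℂ) else 0))) * y⁻¹ :
              ↥(unitaryGroupOfForm (starRingEnd ℂ) (Matrix.of fun i j : Fin 3 => if i.val + j.val + 1 = 3 then (1 : ℂ) else 0))) : GL (Fin 3) ℂ) : Matrix (Fin 3) (Fin 3) ℂ) i j‖ ^ 2 ≤ R →
            (QuotientGroup.mk y : ↥(unitaryGroupOfForm (starRingEnd ℂ) (Matrix.of fun i j : Fin 3 => if i.val + j.val + 1 = 3 then (1 : ℂ) else 0)) ⧸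
              Subgroup.centralizer ({γ₁} : Set _)) ∈ 𝒦 := by
  classical
  -- the Sylvester transport to the ball model
  obtain ⟨e, he, hhs, hcol⟩ := exists_sylvester_continuousMulEquiv_U21
  -- a uniform box constant on `K`
  set R' : ℝ := max R 0 with hR'
  have hR'0 : 0 ≤ R' := le_max_right _ _
  have hcoe : Continuous fun t : ↥(Subgroup.centralizer ({γ₁} : Set ↥(unitaryGroupOfForm (starRingEnd ℂ) (Matrix.of fun i j : Fin 3 => if i.val + j.val + 1 = 3 then (1 : ℂ) else 0)))) =>
      ((((t : ↥(Subgroup.centralizer ({γ₁} : Set _))) : ↥(unitaryGroupOfForm (starRingEnd ℂ) (Matrix.of fun i j : Fin 3 => if i.val + j.val + 1 = 3 then (1 : ℂ) else 0))) :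
        GL (Fin 3) ℂ) : Matrix (Fin 3) (Fin 3) ℂ) 0 0 :=
    (Units.continuous_val.comp (continuous_subtype_val.comp continuous_subtype_val)).matrix_elem 0 0
  obtain ⟨M, hM⟩ := hK.exists_bound_of_continuousOn (continuousOn_boxConst.comp hcoe.continuousOn fun t ht => hKreg t ht)
  -- the compact set in the ball and its proper preimage in `U`
  set CB : Set Ball := (fun W : Fin 2 → ℂ => proj ![W 0, W 1, (Real.sqrt (1 + nsq W) : ℂ)] (Q_vecCons_sqrt_one_add_nsq_neg W)) ''
    {W : Fin 2 → ℂ | nsq W ≤ M * Real.sqrt (R' + 1)} with hCB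
  have hCBc : IsCompact CB := (isCompact_setOf_nsq_le _).image continuous_chart
  set B : Set ↥(unitaryGroupOfForm (starRingEnd ℂ) (Matrix.of fun i j : Fin 3 => if i.val + j.val + 1 = 3 then (1 : ℂ) else 0)) :=
    e ⁻¹' {h : ↥U21 | h • x₀ ∈ CB} with hB
  have hBc : IsCompact B := e.toHomeomorph.isCompact_preimage.2 (isCompact_setOf_smul_x₀_mem hCBc)
  refine ⟨QuotientGroup.mk '' ((fun g => g⁻¹) '' B), (hBc.image continuous_inv).image continuous_quotient_mk', fun t ht y hy => ?_⟩
  -- the data of `t`: diagonal shape, regularity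
  obtain ⟨htM, ht11⟩ := coe_eq_diagHyp_of_mem_centralizer hγ₁ hu₁ hα₁1 t.2
  have ht00 : ‖((((t : ↥(Subgroup.centralizer ({γ₁} : Set _))) : ↥(unitaryGroupOfForm (starRingEnd ℂ) (Matrix.of fun i j : Fin 3 => if i.val + j.val + 1 = 3 then (1 : ℂ) else 0))) :
      GL (Fin 3) ℂ) : Matrix (Fin 3) (Fin 3) ℂ) 0 0‖ ≠ 1 := hKreg t ht
  have ht0 : ((((t : ↥(Subgroup.centralizer ({γ₁} : Set _))) : ↥(unitaryGroupOfForm (starRingEnd ℂ) (Matrix.of fun i j : Fin 3 => if i.val + j.val + 1 = 3 then (1 : ℂ) else 0))) :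
      GL (Fin 3) ℂ) : Matrix (Fin 3) (Fin 3) ℂ) 0 0 ≠ 0 := by
    intro h0
    have hdet : (((((t : ↥(Subgroup.centralizer ({γ₁} : Set _))) : ↥(unitaryGroupOfForm (starRingEnd ℂ) (Matrix.of fun i j : Fin 3 => if i.val + j.val + 1 = 3 then (1 : ℂ) else 0))) :
        GL (Fin 3) ℂ) : Matrix (Fin 3) (Fin 3) ℂ)).det ≠ 0 := by
      rw [← Matrix.GeneralLinearGroup.val_det_apply]; exact Units.ne_zero _
    apply hdet
    rw [htM, h0, Matrix.det_fin_three]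
    simp
  -- `g := y⁻¹` and its slab translate `τ g`
  set g : ↥(unitaryGroupOfForm (starRingEnd ℂ) (Matrix.of fun i j : Fin 3 => if i.val + j.val + 1 = 3 then (1 : ℂ) else 0)) := y⁻¹ with hg
  have hsg := slabFun_pos g
  obtain ⟨τ, hτ⟩ := chi_onto hγ₁ ((3 / 2) / (‖((g : GL (Fin 3) ℂ) : Matrix (Fin 3) (Fin 3) ℂ) 0 0 - ((g : GL (Fin 3) ℂ) : Matrix (Fin 3) (Fin 3) ℂ) 0 2‖ /
    ‖((g : GL (Fin 3) ℂ) : Matrix (Fin 3) (Fin 3) ℂ) 2 0 - ((g : GL (Fin 3) ℂ) : Matrix (Fin 3) (Fin 3) ℂ) 2 2‖)) (div_pos (by norm_num) hsg)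
  -- the eigenvalues of `γ₁` are pairwise distinct
  have hα₁0 : α₁ ≠ 0 := by
    intro h0
    have hdet : (((γ₁ : GL (Fin 3) ℂ) : Matrix (Fin 3) (Fin 3) ℂ)).det ≠ 0 := by
      rw [← Matrix.GeneralLinearGroup.val_det_apply]; exact Units.ne_zero _
    apply hdet
    rw [hγ₁, h0, Matrix.det_fin_three]
    simp
  have hinj := diagHyp_injective hα₁0 hα₁1 hu₁
  have hαu : α₁ ≠ u₁ := fun h => by have := hinj (a₁ := 0) (a₂ := 1) (by simp [h]); exact absurd this (by decide)
  have huβ : u₁ ≠ (star α₁)⁻¹ := fun h => by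
    have := hinj (a₁ := 1) (a₂ := 2) (by simp [h]); exact absurd this (by decide)
  have hαβ : α₁ ≠ (star α₁)⁻¹ := fun h => by
    have := hinj (a₁ := 0) (a₂ := 2) (by simpa using h); exact absurd this (by decide)
  have hslab : ‖((((τ : ↥(unitaryGroupOfForm (starRingEnd ℂ) (Matrix.of fun i j : Fin 3 => if i.val + j.val + 1 = 3 then (1 : ℂ) else 0))) * g :
        ↥(unitaryGroupOfForm (starRingEnd ℂ) (Matrix.of fun i j : Fin 3 => if i.val + j.val + 1 = 3 then (1 : ℂ) else 0))) : GL (Fin 3) ℂ) : Matrix (Fin 3) (Fin 3) ℂ) 0 0 -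
        ((((τ : ↥(unitaryGroupOfForm (starRingEnd ℂ) (Matrix.of fun i j : Fin 3 => if i.val + j.val + 1 = 3 then (1 : ℂ) else 0))) * g :
        ↥(unitaryGroupOfForm (starRingEnd ℂ) (Matrix.of fun i j : Fin 3 => if i.val + j.val + 1 = 3 then (1 : ℂ) else 0))) : GL (Fin 3) ℂ) : Matrix (Fin 3) (Fin 3) ℂ) 0 2‖ /
      ‖((((τ : ↥(unitaryGroupOfForm (starRingEnd ℂ) (Matrix.of fun i j : Fin 3 => if i.val + j.val + 1 = 3 then (1 : ℂ) else 0))) * g :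
        ↥(unitaryGroupOfForm (starRingEnd ℂ) (Matrix.of fun i j : Fin 3 => if i.val + j.val + 1 = 3 then (1 : ℂ) else 0))) : GL (Fin 3) ℂ) : Matrix (Fin 3) (Fin 3) ℂ) 2 0 -
        ((((τ : ↥(unitaryGroupOfForm (starRingEnd ℂ) (Matrix.of fun i j : Fin 3 => if i.val + j.val + 1 = 3 then (1 : ℂ) else 0))) * g :
        ↥(unitaryGroupOfForm (starRingEnd ℂ) (Matrix.of fun i j : Fin 3 => if i.val + j.val + 1 = 3 then (1 : ℂ) else 0))) : GL (Fin 3) ℂ) : Matrix (Fin 3) (Fin 3) ℂ) 2 2‖ ∈ Icc (1 : ℝ) 2 := by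
    rw [slabFun_centralizer_mul hγ₁ hαu huβ hαβ τ g]
    have hχ : ‖(((τ : ↥(Subgroup.centralizer ({γ₁} : Set _))) : ↥(unitaryGroupOfForm (starRingEnd ℂ) (Matrix.of fun i j : Fin 3 => if i.val + j.val + 1 = 3 then (1 : ℂ) else 0))) :
        GL (Fin 3) ℂ).val 0 0‖ ^ 2 = (3 / 2) / (‖((g : GL (Fin 3) ℂ) : Matrix (Fin 3) (Fin 3) ℂ) 0 0 - ((g : GL (Fin 3) ℂ) : Matrix (Fin 3) (Fin 3) ℂ) 0 2‖ /
          ‖((g : GL (Fin 3) ℂ) : Matrix (Fin 3) (Fin 3) ℂ) 2 0 - ((g : GL (Fin 3) ℂ) : Matrix (Fin 3) (Fin 3) ℂ) 2 2‖) := hτ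
    have hχ' : ‖((((τ : ↥(Subgroup.centralizer ({γ₁} : Set _))) : ↥(unitaryGroupOfForm (starRingEnd ℂ) (Matrix.of fun i j : Fin 3 => if i.val + j.val + 1 = 3 then (1 : ℂ) else 0))) :
        GL (Fin 3) ℂ) : Matrix (Fin 3) (Fin 3) ℂ) 0 0‖ ^ 2 = (3 / 2) / (‖((g : GL (Fin 3) ℂ) : Matrix (Fin 3) (Fin 3) ℂ) 0 0 - ((g : GL (Fin 3) ℂ) : Matrix (Fin 3) (Fin 3) ℂ) 0 2‖ /
          ‖((g : GL (Fin 3) ℂ) : Matrix (Fin 3) (Fin 3) ℂ) 2 0 - ((g : GL (Fin 3) ℂ) : Matrix (Fin 3) (Fin 3) ℂ) 2 2‖) := hχ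
    rw [hχ', div_mul_cancel₀ _ hsg.ne']
    constructor <;> norm_num
  -- the orbit-ball condition is `T`-invariant: `(τ g)⁻¹ t (τ g) = g⁻¹ t g = y t y⁻¹`
  have hcomm : (τ : ↥(unitaryGroupOfForm (starRingEnd ℂ) (Matrix.of fun i j : Fin 3 => if i.val + j.val + 1 = 3 then (1 : ℂ) else 0)))⁻¹ *
      (t : ↥(unitaryGroupOfForm (starRingEnd ℂ) (Matrix.of fun i j : Fin 3 => if i.val + j.val + 1 = 3 then (1 : ℂ) else 0))) * τ = t := by
    rw [centralizer_mul_comm_of_diag_hyperbolic hγ₁ hu₁ hα₁1 (Subgroup.inv_mem _ τ.2) t.2, mul_assoc, inv_mul_cancel, mul_one]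
  have hball' : ∑ i : Fin 3, ∑ j : Fin 3, ‖(((((τ : ↥(unitaryGroupOfForm (starRingEnd ℂ) (Matrix.of fun i j : Fin 3 => if i.val + j.val + 1 = 3 then (1 : ℂ) else 0))) * g)⁻¹ *
        (t : ↥(unitaryGroupOfForm (starRingEnd ℂ) (Matrix.of fun i j : Fin 3 => if i.val + j.val + 1 = 3 then (1 : ℂ) else 0))) * ((τ : ↥(unitaryGroupOfForm (starRingEnd ℂ) (Matrix.of fun i j : Fin 3 => if i.val + j.val + 1 = 3 then (1 : ℂ) else 0))) * g) :
        ↥(unitaryGroupOfForm (starRingEnd ℂ) (Matrix.of fun i j : Fin 3 => if i.val + j.val + 1 = 3 then (1 : ℂ) else 0))) : GL (Fin 3) ℂ) : Matrix (Fin 3) (Fin 3) ℂ) i j‖ ^ 2 ≤ R' := by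
    have hconj : ((τ : ↥(unitaryGroupOfForm (starRingEnd ℂ) (Matrix.of fun i j : Fin 3 => if i.val + j.val + 1 = 3 then (1 : ℂ) else 0))) * g)⁻¹ *
        (t : ↥(unitaryGroupOfForm (starRingEnd ℂ) (Matrix.of fun i j : Fin 3 => if i.val + j.val + 1 = 3 then (1 : ℂ) else 0))) * ((τ : ↥(unitaryGroupOfForm (starRingEnd ℂ) (Matrix.of fun i j : Fin 3 => if i.val + j.val + 1 = 3 then (1 : ℂ) else 0))) * g) =
        y * (t : ↥(unitaryGroupOfForm (starRingEnd ℂ) (Matrix.of fun i j : Fin 3 => if i.val + j.val + 1 = 3 then (1 : ℂ) else 0))) * y⁻¹ := by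
      rw [hg]
      calc ((τ : ↥(unitaryGroupOfForm (starRingEnd ℂ) (Matrix.of fun i j : Fin 3 => if i.val + j.val + 1 = 3 then (1 : ℂ) else 0))) * y⁻¹)⁻¹ *
            (t : ↥(unitaryGroupOfForm (starRingEnd ℂ) (Matrix.of fun i j : Fin 3 => if i.val + j.val + 1 = 3 then (1 : ℂ) else 0))) * ((τ : ↥(unitaryGroupOfForm (starRingEnd ℂ) (Matrix.of fun i j : Fin 3 => if i.val + j.val + 1 = 3 then (1 : ℂ) else 0))) * y⁻¹)
          = y * (((τ : ↥(unitaryGroupOfForm (starRingEnd ℂ) (Matrix.of fun i j : Fin 3 => if i.val + j.val + 1 = 3 then (1 : ℂ) else 0)))⁻¹ *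
            (t : ↥(unitaryGroupOfForm (starRingEnd ℂ) (Matrix.of fun i j : Fin 3 => if i.val + j.val + 1 = 3 then (1 : ℂ) else 0))) * τ)) * y⁻¹ := by group
        _ = y * (t : ↥(unitaryGroupOfForm (starRingEnd ℂ) (Matrix.of fun i j : Fin 3 => if i.val + j.val + 1 = 3 then (1 : ℂ) else 0))) * y⁻¹ := by rw [hcomm]
    rw [hconj]
    exact hy.trans (le_max_left _ _)
  -- the ball picture at `t`
  have hmem := hsOrbitBall_inter_slab_subset_preimage htM e he hhs hcol R' ⟨hball', hslab⟩
  simp only [Set.mem_preimage, Set.mem_setOf_eq] at hmem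
  obtain ⟨hD, hDslab⟩ := hmem
  -- THE BOX: the ball point has a chart preimage with `|W|² ≤ K(t₀₀) √(R'+1) ≤ M √(R'+1)`
  have hτgB : (τ : ↥(unitaryGroupOfForm (starRingEnd ℂ) (Matrix.of fun i j : Fin 3 => if i.val + j.val + 1 = 3 then (1 : ℂ) else 0))) * g ∈ B := by
    rw [hB, Set.mem_preimage, Set.mem_setOf_eq, hCB, Set.mem_image]
    set z : Ball := e ((τ : ↥(unitaryGroupOfForm (starRingEnd ℂ) (Matrix.of fun i j : Fin 3 => if i.val + j.val + 1 = 3 then (1 : ℂ) else 0))) * g) • x₀ with hz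
    obtain ⟨W, hW⟩ : ∃ W : Fin 2 → ℂ, proj ![W 0, W 1, (Real.sqrt (1 + nsq W) : ℂ)] (Q_vecCons_sqrt_one_add_nsq_neg W) = z :=
      ⟨_, chart_unchart z⟩
    refine ⟨W, ?_, hW⟩
    rw [← hW] at hD hDslab
    have hbox := nsq_le_of_chart_mem_hsOrbitBall_slab ht11 ht0 ht00 hR'0 hD hDslab
    have hKt := hM t ht
    rw [Function.comp_apply, Real.norm_eq_abs] at hKt
    have hKt' := (le_abs_self _).trans hKt
    calc nsq W ≤ _ := hbox
      _ ≤ M * Real.sqrt (R' + 1) := by gcongr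
  -- `ȳ = (τ g)⁻¹ · T`
  refine ⟨((τ : ↥(unitaryGroupOfForm (starRingEnd ℂ) (Matrix.of fun i j : Fin 3 => if i.val + j.val + 1 = 3 then (1 : ℂ) else 0))) * g)⁻¹, ⟨_, hτgB, rfl⟩, ?_⟩
  rw [hg, mul_inv_rev, inv_inv]
  apply QuotientGroup.eq.2
  rw [mul_inv_rev, inv_inv, inv_mul_cancel_right]
  exact τ.2

end Proper

/-! ## §3 (L3) Continuity on `T_reg` of the Weil-quotient orbital integral along the split Cartan -/

section Continuity

variable {γ₁ : ↥(unitaryGroupOfForm (starRingEnd ℂ) (Matrix.of fun i j : Fin 3 => if i.val + j.val + 1 = 3 then (1 : ℂ) else 0))} {α₁ u₁ : ℂ}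
  (hγ₁ : ((γ₁ : GL (Fin 3) ℂ) : Matrix (Fin 3) (Fin 3) ℂ) = !![α₁, 0, 0; 0, u₁, 0; 0, 0, (star α₁)⁻¹]) (hu₁ : ‖u₁‖ = 1) (hα₁1 : ‖α₁‖ ≠ 1)
  [MeasurableSpace (↥(unitaryGroupOfForm (starRingEnd ℂ) (Matrix.of fun i j : Fin 3 => if i.val + j.val + 1 = 3 then (1 : ℂ) else 0)) ⧸ Subgroup.centralizer ({γ₁} : Set ↥(unitaryGroupOfForm (starRingEnd ℂ) (Matrix.of fun i j : Fin 3 => if i.val + j.val + 1 = 3 then (1 : ℂ) else 0))))] [BorelSpace (↥(unitaryGroupOfForm (starRingEnd ℂ) (Matrix.of fun i j : Fin 3 => if i.val + j.val + 1 = 3 then (1 : ℂ) else 0)) ⧸ Subgroup.centralizer ({γ₁} : Set ↥(unitaryGroupOfForm (starRingEnd ℂ) (Matrix.of fun i j : Fin 3 => if i.val + j.val + 1 = 3 then (1 : ℂ) else 0))))]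
  {E : Type*} [NormedAddCommGroup E] [NormedSpace ℝ E]

include hγ₁ hu₁ hα₁1 in
/-- **(L3) THE WEIL-QUOTIENT ORBITAL INTEGRAL IS CONTINUOUS ALONG THE REGULAR PART OF THE SPLIT CARTAN.**  For `a ∈ C_c(U, E)` and ANY measure `μ` on `U ⧸ T`
finite on compact sets (`T = Z(γ₁)`; e.g. the Weil quotient `dν ∕ dt_T` of ★ `quotientMeasure` for ONE Haar measure `t_T` on `T`), the function
`t ↦ ∫_{U ⧸ T} a(y t y⁻¹) dμ(ȳ)` (★ `descConj`) is continuous on `T_reg = {t ∣ |t₀₀| ≠ 1}`: on a compact neighbourhood of a regular point the integrands are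
supported in ONE compact set (§2) and depend continuously on `(t, ȳ)` (open quotient map `id × mk`), so Mathlib's `continuousOn_integral_of_compact_support` applies.
The non-compact-Cartan twin of ★ `continuousOn_integral_descConj_archDiagTorus_of_hasCompactSupport`. [cite: Rogawski1990, §8.3 p. 122] [cite: Shelstad1979, §4]
[cite: DeitmarEchterhoff2014, Lemma 9.3.3] [cite: BeuzartPlessis2020Asterisque, §1.8 p. 39] -/
theorem continuousOn_integral_descConj_of_diag_hyperbolic
    (μ : Measure (↥(unitaryGroupOfForm (starRingEnd ℂ) (Matrix.of fun i j : Fin 3 => if i.val + j.val + 1 = 3 then (1 : ℂ) else 0)) ⧸ Subgroup.centralizer ({γ₁} : Set ↥(unitaryGroupOfForm (starRingEnd ℂ) (Matrix.of fun i j : Fin 3 => if i.val + j.val + 1 = 3 then (1 : ℂ) else 0))))) [IsFiniteMeasureOnCompacts μ]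
    (a : ↥(unitaryGroupOfForm (starRingEnd ℂ) (Matrix.of fun i j : Fin 3 => if i.val + j.val + 1 = 3 then (1 : ℂ) else 0)) → E) (ha : Continuous a) (hac : HasCompactSupport a) :
    ContinuousOn (fun t : ↥(Subgroup.centralizer ({γ₁} : Set ↥(unitaryGroupOfForm (starRingEnd ℂ) (Matrix.of fun i j : Fin 3 => if i.val + j.val + 1 = 3 then (1 : ℂ) else 0)))) =>
        ∫ x, descConj (t : ↥(unitaryGroupOfForm (starRingEnd ℂ) (Matrix.of fun i j : Fin 3 => if i.val + j.val + 1 = 3 then (1 : ℂ) else 0))) (Subgroup.centralizer ({γ₁} : Set ↥(unitaryGroupOfForm (starRingEnd ℂ) (Matrix.of fun i j : Fin 3 => if i.val + j.val + 1 = 3 then (1 : ℂ) else 0)))) (forall_mem_centralizer_mul_comm hγ₁ hu₁ hα₁1 t) a x ∂μ)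
      {t | ‖((((t : ↥(Subgroup.centralizer ({γ₁} : Set ↥(unitaryGroupOfForm (starRingEnd ℂ) (Matrix.of fun i j : Fin 3 => if i.val + j.val + 1 = 3 then (1 : ℂ) else 0))))) : ↥(unitaryGroupOfForm (starRingEnd ℂ) (Matrix.of fun i j : Fin 3 => if i.val + j.val + 1 = 3 then (1 : ℂ) else 0))) : GL (Fin 3) ℂ) : Matrix (Fin 3) (Fin 3) ℂ) 0 0‖ ≠ 1} := by
  classical
  -- instances: `U` locally compact (so `T`, closed, is locally compact)
  haveI : LocallyCompactSpace ↥(unitaryGroupOfForm (starRingEnd ℂ) (Matrix.of fun i j : Fin 3 => if i.val + j.val + 1 = 3 then (1 : ℂ) else 0)) := locallyCompactSpace_unitaryGroupOfForm_complex _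
  have hZc : IsClosed ((Subgroup.centralizer ({γ₁} : Set ↥(unitaryGroupOfForm (starRingEnd ℂ) (Matrix.of fun i j : Fin 3 => if i.val + j.val + 1 = 3 then (1 : ℂ) else 0)))) : Set ↥(unitaryGroupOfForm (starRingEnd ℂ) (Matrix.of fun i j : Fin 3 => if i.val + j.val + 1 = 3 then (1 : ℂ) else 0))) := isClosed_coe_centralizer_singleton γ₁
  haveI : LocallyCompactSpace ↥(Subgroup.centralizer ({γ₁} : Set ↥(unitaryGroupOfForm (starRingEnd ℂ) (Matrix.of fun i j : Fin 3 => if i.val + j.val + 1 = 3 then (1 : ℂ) else 0)))) := hZc.isClosedEmbedding_subtypeVal.locallyCompactSpace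
  -- the regular set is open
  have hcoe : Continuous fun t : ↥(Subgroup.centralizer ({γ₁} : Set ↥(unitaryGroupOfForm (starRingEnd ℂ) (Matrix.of fun i j : Fin 3 => if i.val + j.val + 1 = 3 then (1 : ℂ) else 0)))) => ((((t : ↥(Subgroup.centralizer ({γ₁} : Set ↥(unitaryGroupOfForm (starRingEnd ℂ) (Matrix.of fun i j : Fin 3 => if i.val + j.val + 1 = 3 then (1 : ℂ) else 0))))) : ↥(unitaryGroupOfForm (starRingEnd ℂ) (Matrix.of fun i j : Fin 3 => if i.val + j.val + 1 = 3 then (1 : ℂ) else 0))) : GL (Fin 3) ℂ) : Matrix (Fin 3) (Fin 3) ℂ) 0 0 :=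
    (Units.continuous_val.comp (continuous_subtype_val.comp continuous_subtype_val)).matrix_elem 0 0
  have hopen : IsOpen {t : ↥(Subgroup.centralizer ({γ₁} : Set ↥(unitaryGroupOfForm (starRingEnd ℂ) (Matrix.of fun i j : Fin 3 => if i.val + j.val + 1 = 3 then (1 : ℂ) else 0)))) | ‖((((t : ↥(Subgroup.centralizer ({γ₁} : Set ↥(unitaryGroupOfForm (starRingEnd ℂ) (Matrix.of fun i j : Fin 3 => if i.val + j.val + 1 = 3 then (1 : ℂ) else 0))))) : ↥(unitaryGroupOfForm (starRingEnd ℂ) (Matrix.of fun i j : Fin 3 => if i.val + j.val + 1 = 3 then (1 : ℂ) else 0))) : GL (Fin 3) ℂ) : Matrix (Fin 3) (Fin 3) ℂ) 0 0‖ ≠ 1} :=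
    isOpen_ne_fun hcoe.norm continuous_const
  -- a bound for the HS radius on the support of `a`
  have hHS : Continuous fun v : ↥(unitaryGroupOfForm (starRingEnd ℂ) (Matrix.of fun i j : Fin 3 => if i.val + j.val + 1 = 3 then (1 : ℂ) else 0)) => ∑ i : Fin 3, ∑ j : Fin 3, ‖((v : GL (Fin 3) ℂ) : Matrix (Fin 3) (Fin 3) ℂ) i j‖ ^ 2 := by
    have hA : Continuous fun v : ↥(unitaryGroupOfForm (starRingEnd ℂ) (Matrix.of fun i j : Fin 3 => if i.val + j.val + 1 = 3 then (1 : ℂ) else 0)) => ((v : GL (Fin 3) ℂ) : Matrix (Fin 3) (Fin 3) ℂ) := Units.continuous_val.comp continuous_subtype_val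
    refine continuous_finsetSum _ fun i _ => continuous_finsetSum _ fun j _ => ?_
    exact (continuous_norm.comp (hA.matrix_elem i j)).pow 2
  obtain ⟨R₀, hR₀⟩ := hac.isCompact.exists_bound_of_continuousOn hHS.continuousOn
  -- joint continuity of the integrand on `T × (U ⧸ T)`
  have hF : Continuous fun p : ↥(Subgroup.centralizer ({γ₁} : Set ↥(unitaryGroupOfForm (starRingEnd ℂ) (Matrix.of fun i j : Fin 3 => if i.val + j.val + 1 = 3 then (1 : ℂ) else 0)))) × (↥(unitaryGroupOfForm (starRingEnd ℂ) (Matrix.of fun i j : Fin 3 => if i.val + j.val + 1 = 3 then (1 : ℂ) else 0)) ⧸ Subgroup.centralizer ({γ₁} : Set ↥(unitaryGroupOfForm (starRingEnd ℂ) (Matrix.of fun i j : Fin 3 => if i.val + j.val + 1 = 3 then (1 : ℂ) else 0)))) =>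
      descConj (p.1 : ↥(unitaryGroupOfForm (starRingEnd ℂ) (Matrix.of fun i j : Fin 3 => if i.val + j.val + 1 = 3 then (1 : ℂ) else 0))) (Subgroup.centralizer ({γ₁} : Set ↥(unitaryGroupOfForm (starRingEnd ℂ) (Matrix.of fun i j : Fin 3 => if i.val + j.val + 1 = 3 then (1 : ℂ) else 0)))) (forall_mem_centralizer_mul_comm hγ₁ hu₁ hα₁1 p.1) a p.2 := by
    have hq : IsOpenQuotientMap (Prod.map (id : ↥(Subgroup.centralizer ({γ₁} : Set ↥(unitaryGroupOfForm (starRingEnd ℂ) (Matrix.of fun i j : Fin 3 => if i.val + j.val + 1 = 3 then (1 : ℂ) else 0)))) → ↥(Subgroup.centralizer ({γ₁} : Set ↥(unitaryGroupOfForm (starRingEnd ℂ) (Matrix.of fun i j : Fin 3 => if i.val + j.val + 1 = 3 then (1 : ℂ) else 0))))) (QuotientGroup.mk : ↥(unitaryGroupOfForm (starRingEnd ℂ) (Matrix.of fun i j : Fin 3 => if i.val + j.val + 1 = 3 then (1 : ℂ) else 0)) → ↥(unitaryGroupOfForm (starRingEnd ℂ) (Matrix.of fun i j : Fin 3 =>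 if i.val + j.val + 1 = 3 then (1 : ℂ) else 0)) ⧸ Subgroup.centralizer ({γ₁} : Set ↥(unitaryGroupOfForm (starRingEnd ℂ) (Matrix.of fun i j : Fin 3 => if i.val + j.val + 1 = 3 then (1 : ℂ) else 0))))) :=
      IsOpenQuotientMap.id.prodMap QuotientGroup.isOpenQuotientMap_mk
    rw [← hq.continuous_comp_iff]
    have h2 : (fun p : ↥(Subgroup.centralizer ({γ₁} : Set ↥(unitaryGroupOfForm (starRingEnd ℂ) (Matrix.of fun i j : Fin 3 => if i.val + j.val + 1 = 3 then (1 : ℂ) else 0)))) × (↥(unitaryGroupOfForm (starRingEnd ℂ) (Matrix.of fun i j : Fin 3 => if i.val + j.val + 1 = 3 then (1 : ℂ) else 0)) ⧸ Subgroup.centralizer ({γ₁} : Set ↥(unitaryGroupOfForm (starRingEnd ℂ) (Matrix.of fun i j : Fin 3 => if i.val + j.val + 1 = 3 then (1 : ℂ) else 0)))) => descConj (p.1 : ↥(unitaryGroupOfForm (starRingEnd ℂ) (Matrix.of fun i j : Fin 3 => if i.val + j.val + 1 = 3 then (1 : ℂ) else 0))) (Subgroup.centralizer ({γ₁} : Set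 ↥(unitaryGroupOfForm (starRingEnd ℂ) (Matrix.of fun i j : Fin 3 => if i.val + j.val + 1 = 3 then (1 : ℂ) else 0)))) (forall_mem_centralizer_mul_comm hγ₁ hu₁ hα₁1 p.1) a p.2) ∘
        Prod.map (id : ↥(Subgroup.centralizer ({γ₁} : Set ↥(unitaryGroupOfForm (starRingEnd ℂ) (Matrix.of fun i j : Fin 3 => if i.val + j.val + 1 = 3 then (1 : ℂ) else 0)))) → ↥(Subgroup.centralizer ({γ₁} : Set ↥(unitaryGroupOfForm (starRingEnd ℂ) (Matrix.of fun i j : Fin 3 => if i.val + j.val + 1 = 3 then (1 : ℂ) else 0))))) (QuotientGroup.mk : ↥(unitaryGroupOfForm (starRingEnd ℂ) (Matrix.of fun i j : Fin 3 => if i.val + j.val + 1 = 3 then (1 : ℂ) else 0)) → ↥(unitaryGroupOfForm (starRingEnd ℂ) (Matrix.of fun i j : Fin 3 => if i.val + j.val + 1 = 3 then (1 : ℂ) else 0)) ⧸ Subgroup.centralizer ({γ₁} : Set ↥(unitaryGroupOfForm (starRingEnd ℂ) (Matrix.of fun i j : Fin 3 => if i.val + j.val + 1 = 3 then (1 : ℂ)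 else 0)))) =
        fun p : ↥(Subgroup.centralizer ({γ₁} : Set ↥(unitaryGroupOfForm (starRingEnd ℂ) (Matrix.of fun i j : Fin 3 => if i.val + j.val + 1 = 3 then (1 : ℂ) else 0)))) × ↥(unitaryGroupOfForm (starRingEnd ℂ) (Matrix.of fun i j : Fin 3 => if i.val + j.val + 1 = 3 then (1 : ℂ) else 0)) => a (p.2 * (p.1 : ↥(unitaryGroupOfForm (starRingEnd ℂ) (Matrix.of fun i j : Fin 3 => if i.val + j.val + 1 = 3 then (1 : ℂ) else 0))) * p.2⁻¹) := by
      funext p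
      rfl
    rw [h2]
    exact ha.comp ((continuous_snd.mul (continuous_subtype_val.comp continuous_fst)).mul continuous_snd.inv)
  intro t₀ ht₀
  obtain ⟨K, hKnhds, hKsub, hK⟩ := local_compact_nhds (hopen.mem_nhds ht₀)
  obtain ⟨𝒦, h𝒦, hmem⟩ := exists_isCompact_forall_hsOrbit_subset_of_diag_hyperbolic hγ₁ hu₁ hα₁1 hK (fun t ht => hKsub ht) R₀
  have hcont : ContinuousOn (fun t : ↥(Subgroup.centralizer ({γ₁} : Set ↥(unitaryGroupOfForm (starRingEnd ℂ) (Matrix.of fun i j : Fin 3 => if i.val + j.val + 1 = 3 then (1 : ℂ) else 0)))) =>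
      ∫ x, descConj (t : ↥(unitaryGroupOfForm (starRingEnd ℂ) (Matrix.of fun i j : Fin 3 => if i.val + j.val + 1 = 3 then (1 : ℂ) else 0))) (Subgroup.centralizer ({γ₁} : Set ↥(unitaryGroupOfForm (starRingEnd ℂ) (Matrix.of fun i j : Fin 3 => if i.val + j.val + 1 = 3 then (1 : ℂ) else 0)))) (forall_mem_centralizer_mul_comm hγ₁ hu₁ hα₁1 t) a x ∂μ) K := by
    refine continuousOn_integral_of_compact_support h𝒦 hF.continuousOn ?_
    intro t x ht hx
    induction x using QuotientGroup.induction_on with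
    | H y =>
      rw [descConj_mk]
      by_contra hne
      have hsupp : y * (t : ↥(unitaryGroupOfForm (starRingEnd ℂ) (Matrix.of fun i j : Fin 3 => if i.val + j.val + 1 = 3 then (1 : ℂ) else 0))) * y⁻¹ ∈ tsupport a := subset_tsupport _ (Function.mem_support.2 hne)
      have h' := hR₀ _ hsupp
      rw [Real.norm_of_nonneg (by positivity)] at h'
      exact hx (hmem t ht y h')
  exact ((continuousWithinAt_iff_continuousAt hKnhds).mp (hcont t₀ (mem_of_mem_nhds hKnhds))).continuousWithinAt

include hγ₁ hu₁ hα₁1 in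
/-- **(L3′) ALONG ANY CONTINUOUS FAMILY IN THE SPLIT CARTAN** — e.g. the partner family `c(x, θ, z₁) = diag(e^{x+iθ}, z₁, e^{-x+iθ})` of a split `H`-torus at an indefinite
place (regular iff `x ≠ 0`): `z ↦ ∫_{U ⧸ T} a(y c(z) y⁻¹) dμ(ȳ)` is continuous on `{z ∣ |c(z)₀₀| ≠ 1}`. [cite: Rogawski1990, §8.3 p. 122] [cite: Shelstad1979, §4] -/
theorem continuousOn_integral_descConj_comp_of_diag_hyperbolic
    (μ : Measure (↥(unitaryGroupOfForm (starRingEnd ℂ) (Matrix.of fun i j : Fin 3 => if i.val + j.val + 1 = 3 then (1 : ℂ) else 0)) ⧸ Subgroup.centralizer ({γ₁} : Set ↥(unitaryGroupOfForm (starRingEnd ℂ) (Matrix.of fun i j : Fin 3 => if i.val + j.val + 1 = 3 then (1 : ℂ) else 0))))) [IsFiniteMeasureOnCompacts μ]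
    (a : ↥(unitaryGroupOfForm (starRingEnd ℂ) (Matrix.of fun i j : Fin 3 => if i.val + j.val + 1 = 3 then (1 : ℂ) else 0)) → E) (ha : Continuous a) (hac : HasCompactSupport a)
    {X : Type*} [TopologicalSpace X] (c : X → ↥(Subgroup.centralizer ({γ₁} : Set ↥(unitaryGroupOfForm (starRingEnd ℂ) (Matrix.of fun i j : Fin 3 => if i.val + j.val + 1 = 3 then (1 : ℂ) else 0))))) (hc : Continuous c) :
    ContinuousOn (fun z : X =>
        ∫ x, descConj (c z : ↥(unitaryGroupOfForm (starRingEnd ℂ) (Matrix.of fun i j : Fin 3 => if i.val + j.val + 1 = 3 then (1 : ℂ) else 0))) (Subgroup.centralizer ({γ₁} : Set ↥(unitaryGroupOfForm (starRingEnd ℂ) (Matrix.of fun i j : Fin 3 => if i.val + j.val + 1 = 3 then (1 : ℂ) else 0)))) (forall_mem_centralizer_mul_comm hγ₁ hu₁ hα₁1 (c z)) a x ∂μ)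
      {z | ‖((((c z : ↥(Subgroup.centralizer ({γ₁} : Set ↥(unitaryGroupOfForm (starRingEnd ℂ) (Matrix.of fun i j : Fin 3 => if i.val + j.val + 1 = 3 then (1 : ℂ) else 0))))) : ↥(unitaryGroupOfForm (starRingEnd ℂ) (Matrix.of fun i j : Fin 3 => if i.val + j.val + 1 = 3 then (1 : ℂ) else 0))) : GL (Fin 3) ℂ) : Matrix (Fin 3) (Fin 3) ℂ) 0 0‖ ≠ 1} :=
  (continuousOn_integral_descConj_of_diag_hyperbolic hγ₁ hu₁ hα₁1 μ a ha hac).comp hc.continuousOn fun _ hz => hz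

end Continuity

end Literature.NumberTheory.Rogawski1990

end
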